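import Summits.BirchSwinnertonDyer.BirchSwinnertonDyer.Theorems.ResidualThetaTransportAtTwoThetaLayerLambdaCongruenceAtTwoHeckeAdjointFlagSide
import HarnessLib

/-!
# Crux `ThetaLayerLambdaCongruenceAtTwo` (stmt-BirchSwinnertonDyer-20688, route ResidualThetaTransportAtTwo), line
# `birth` v14 — SD floor, kernel road, Hecke clause of IP, brick HA5a «DISCRETE JORDAN LEMMA, sequence form»: along a convex Farey
# chain `P₀ = (1,0), P₁, …, P_m` the number of edges `P_j → P_{j+1}` having a given flag on their positive side equals the same
# indicator for the long edge `P₀ → P_m`, except for finitely many flags sitting at the vertices (width seat bsd-wall-rtt-p3-w3 g11;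
# `--supports stmt-BirchSwinnertonDyer-20688 --as helper`; closes nothing)

HONEST FRAMING. Elementary THEOREMS about finite integer sequences; no definition; nothing about any curve or form is asserted; BSD is not
proved by any of this.

WHY (memo `Cruxes/ThetaLayerLambdaCongruenceAtTwo/Lines/birth-sd2-hecke-adjoint.md`, step (E), brick HA5). For the re-expansion
`f_j = [P_{j−1} | P_j]` of a generalised edge (brick HA4) and a flag matrix `A = (a b; c e) ∈ SL₂(ℤ)` put `s_j = x_j c − y_j a`,
`t_j = x_j e − y_j b`; then `f_j⁻¹A = (−s_{j+1} −t_{j+1}; s_j t_j)` and `adj(H)A = (−d s_m, −d t_m; u s_0, u t_0)`, so every flag-side term of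
the Jordan correction `κ_H(A) = Σ_j F(f_j⁻¹A) − F(adj(H)A)` is the lexicographic indicator `Φ(i,k)` of `(s,t)` at two indices. Here (pure
sequences): convexity (`negCF_cross_pos`); sign persistence; GENERIC VANISHING `Σ_{j<m} Φ(j,j+1) = Φ(0,m)` when no `s_j` vanishes
(`jordan_generic`); at a vertex `P_i`: `(a,c) = εP_i`, `t_i = ε` (`jordan_vertex_shape`) and the values of `Φ` on non-incident, incoming,
outgoing and long edges (`jordan_vertex_*`). Brick HA5b bounds the exceptional flags; HA5c transports to `{A : κ_C(A) ≠ 0}` finite.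

References: [Manin1972] §1.5; [CremonaAlgorithms1997] §2.2; [Merel1995Homologie] §1.2 (sides of perturbed paths).
-/

set_option autoImplicit false

noncomputable section

-- justification: the `Summit.BirchSwinnertonDyer.BirchSwinnertonDyer.…` path repeats a component (route-file convention)
set_option linter.dupNamespace false

open scoped Classical

namespace Summit.BirchSwinnertonDyer.BirchSwinnertonDyer.Theorems.ThetaLayerLambdaCongruenceAtTwo

/-! ## §1. Convexity of a negative-continued-fraction chain -/

section Convex

/-- **Convexity.** For a chain `P_j = (x_j, y_j)` with `y_0 = 0`, `y_j > 0` (`1 ≤ j ≤ m`) and `x_j y_{j+1} − x_{j+1} y_j = 1`, ALL cross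
determinants are positive: `x_j y_k − x_k y_j > 0` for `j < k ≤ m` (the vertices `x_j/y_j` decrease strictly). Induction on `k` with
`y_k·D(j,k+1) = D(j,k)·y_{k+1} + D(k,k+1)·y_j`. [folklore] -/
theorem negCF_cross_pos (m : ℕ) (x y : ℕ → ℤ) (hy0 : y 0 = 0) (hypos : ∀ j, 1 ≤ j → j ≤ m → 0 < y j)
    (hdet : ∀ j, j < m → x j * y (j + 1) - x (j + 1) * y j = 1) :
    ∀ j k, j < k → k ≤ m → 0 < x j * y k - x k * y j := by
  intro j k hjk hkm
  obtain ⟨g, rfl⟩ : ∃ g, k = j + 1 + g := ⟨k - (j + 1), by omega⟩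
  induction g with
  | zero => rw [add_zero, hdet j (by omega)]; exact one_pos
  | succ g ih =>
    have ih' := ih (by omega) (by omega)
    have hk1 : 0 < y (j + 1 + g) := hypos _ (by omega) (by omega)
    have hk2 : 0 < y (j + 1 + g + 1) := hypos _ (by omega) (by omega)
    have hyj : 0 ≤ y j := by
      rcases Nat.eq_zero_or_pos j with rfl | hj
      · rw [hy0]
      · exact (hypos j hj (by omega)).le
    have hd := hdet (j + 1 + g) (by omega)
    have key : y (j + 1 + g) * (x j * y (j + 1 + g + 1) - x (j + 1 + g + 1) * y j) =
        (x j * y (j + 1 + g) - x (j + 1 + g) * y j) * y (j + 1 + g + 1) + y j := by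
      linear_combination y j * hd
    rw [show j + 1 + (g + 1) = j + 1 + g + 1 by omega]
    by_contra hneg
    push Not at hneg
    have h1 : y (j + 1 + g) * (x j * y (j + 1 + g + 1) - x (j + 1 + g + 1) * y j) ≤ 0 :=
      mul_nonpos_of_nonneg_of_nonpos hk1.le hneg
    nlinarith

end Convex

/-! ## §2. The generic case: no vertex -/

section Generic

/-- **The recursion** `s_j y_{j+1} − s_{j+1} y_j = s_0` for `s_j = x_j c − y_j a` along the chain (`x_0 = 1`, `y_0 = 0`). [folklore] -/
theorem negCF_seq_rec (m : ℕ) (x y : ℕ → ℤ) (hx0 : x 0 = 1) (hy0 : y 0 = 0)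
    (hdet : ∀ j, j < m → x j * y (j + 1) - x (j + 1) * y j = 1) (a c : ℤ) (j : ℕ) (hj : j < m) :
    (x j * c - y j * a) * y (j + 1) - (x (j + 1) * c - y (j + 1) * a) * y j = x 0 * c - y 0 * a := by
  rw [hx0, hy0]
  linear_combination c * hdet j hj

/-- **One-sidedness of the signs**: if `s_0 = c > 0` and `s_j < 0` then `s_k < 0` for all `j ≤ k ≤ m` (the vertices are monotone). [folklore] -/
theorem negCF_sign_persist (m : ℕ) (x y : ℕ → ℤ) (hx0 : x 0 = 1) (hy0 : y 0 = 0) (hypos : ∀ j, 1 ≤ j → j ≤ m → 0 < y j)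
    (hdet : ∀ j, j < m → x j * y (j + 1) - x (j + 1) * y j = 1) (a c : ℤ) (hc : 0 < c)
    (j k : ℕ) (hjk : j ≤ k) (hkm : k ≤ m) (hj : x j * c - y j * a < 0) : x k * c - y k * a < 0 := by
  obtain ⟨g, rfl⟩ : ∃ g, k = j + g := ⟨k - j, by omega⟩
  induction g with
  | zero => simpa using hj
  | succ g ih =>
    have ih' := ih (by omega) (by omega)
    have hrec := negCF_seq_rec m x y hx0 hy0 hdet a c (j + g) (by omega)
    rw [hx0, hy0, one_mul, zero_mul, sub_zero] at hrec
    have hj1 : 1 ≤ j + g := by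
      rcases Nat.eq_zero_or_pos (j + g) with h0 | h0
      · exfalso
        have : j = 0 := by omega
        subst this
        simp only [zero_add] at h0
        subst h0
        rw [hx0, hy0] at ih'
        linarith
      · exact h0
    have hy1 : 0 < y (j + g) := hypos _ hj1 (by omega)
    have hy2 : 0 < y (j + g + 1) := hypos _ (by omega) (by omega)
    rw [show j + (g + 1) = j + g + 1 by omega]
    by_contra hneg
    push Not at hneg
    nlinarith [mul_nonneg hneg hy1.le]

/-- **Generic vanishing of the Jordan correction (sign-change count).** If no `s_j = x_j c − y_j a` vanishes (`0 ≤ j ≤ m`), the number of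
`j < m` with `s_j s_{j+1} < 0` equals `[s_0 s_m < 0]`: a flag at a cusp that is not a vertex of the convex chain lies on the positive side of
exactly as many short edges as of the long edge. [cite: Merel1995Homologie, §1.2] -/
theorem jordan_generic_count (m : ℕ) (x y : ℕ → ℤ) (hx0 : x 0 = 1) (hy0 : y 0 = 0) (hypos : ∀ j, 1 ≤ j → j ≤ m → 0 < y j)
    (hdet : ∀ j, j < m → x j * y (j + 1) - x (j + 1) * y j = 1) (a c : ℤ) (hne : ∀ j, j ≤ m → x j * c - y j * a ≠ 0) :
    (∑ j ∈ Finset.range m, (if (x j * c - y j * a) * (x (j + 1) * c - y (j + 1) * a) < 0 then (1 : ℤ) else 0)) =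
      if (x 0 * c - y 0 * a) * (x m * c - y m * a) < 0 then (1 : ℤ) else 0 := by
  have hc0 : c ≠ 0 := by have := hne 0 (Nat.zero_le _); rw [hx0, hy0] at this; simpa using this
  induction m with
  | zero =>
    simp only [Finset.range_zero, Finset.sum_empty, hx0, hy0, one_mul, zero_mul, sub_zero]
    rw [if_neg (by nlinarith [mul_self_nonneg c])]
  | succ m ih =>
    have ih' := ih (fun j hj hjm ↦ hypos j hj (by omega)) (fun j hj ↦ hdet j (by omega)) (fun j hj ↦ hne j (by omega))
    rw [Finset.sum_range_succ, ih']
    rw [hx0, hy0, one_mul, zero_mul, sub_zero]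
    have hsm := hne m (by omega)
    have hsm1 := hne (m + 1) le_rfl
    rcases lt_or_gt_of_ne hc0 with hcneg | hcpos
    · -- `c < 0`: once `s_j > 0`, it stays `> 0`
      have persist : ∀ j k, j ≤ k → k ≤ m + 1 → 0 < x j * c - y j * a → 0 < x k * c - y k * a := by
        intro j k hjk hkm hj
        have h := negCF_sign_persist (m + 1) x y hx0 hy0 hypos hdet (-a) (-c) (by linarith) j k hjk hkm (by linarith)
        linarith
      by_cases h1 : 0 < x m * c - y m * a
      · have h2 := persist m (m + 1) (by omega) le_rfl h1
        rw [if_pos (mul_neg_of_neg_of_pos hcneg h1), if_neg (by nlinarith), if_pos (mul_neg_of_neg_of_pos hcneg h2)]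
        norm_num
      · have h1' : x m * c - y m * a < 0 := lt_of_le_of_ne (not_lt.mp h1) hsm
        by_cases h2 : 0 < x (m + 1) * c - y (m + 1) * a
        · rw [if_neg (by nlinarith), if_pos (mul_neg_of_neg_of_pos h1' h2), if_pos (mul_neg_of_neg_of_pos hcneg h2)]
          norm_num
        · have h2' : x (m + 1) * c - y (m + 1) * a < 0 := lt_of_le_of_ne (not_lt.mp h2) hsm1
          rw [if_neg (by nlinarith), if_neg (by nlinarith), if_neg (by nlinarith)]
          norm_num
    · -- `c > 0`: once `s_j < 0`, it stays `< 0`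
      have persist : ∀ j k, j ≤ k → k ≤ m + 1 → x j * c - y j * a < 0 → x k * c - y k * a < 0 :=
        fun j k hjk hkm hj ↦ negCF_sign_persist (m + 1) x y hx0 hy0 hypos hdet a c hcpos j k hjk hkm hj
      by_cases h1 : x m * c - y m * a < 0
      · have h2 := persist m (m + 1) (by omega) le_rfl h1
        rw [if_pos (mul_neg_of_pos_of_neg hcpos h1), if_neg (by nlinarith), if_pos (mul_neg_of_pos_of_neg hcpos h2)]
        norm_num
      · have h1' : 0 < x m * c - y m * a := lt_of_le_of_ne (not_lt.mp h1) (Ne.symm hsm)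
        by_cases h2 : x (m + 1) * c - y (m + 1) * a < 0
        · rw [if_neg (by nlinarith), if_pos (mul_neg_of_pos_of_neg h1' h2), if_pos (mul_neg_of_pos_of_neg hcpos h2)]
          norm_num
        · have h2' : 0 < x (m + 1) * c - y (m + 1) * a := lt_of_le_of_ne (not_lt.mp h2) (Ne.symm hsm1)
          rw [if_neg (by nlinarith), if_neg (by nlinarith), if_neg (by nlinarith)]
          norm_num

end Generic

/-! ## §3. The lexicographic indicator `Φ(i,k)` of the pair `(s,t)` and the generic vanishing -/

section Phi

/-- **Generic vanishing of the Jordan correction.** With `s_j = x_j c − y_j a`, `t_j = x_j e − y_j b` and the lexicographic flag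
indicator `Φ(i,k) = F(−s_k, −t_k; s_i, t_i)` (= the flag side of `(a b; c e)·φ₀` w.r.t. the edge `[P_i | P_k]`): if no `s_j` vanishes then
`Σ_{j<m} Φ(j,j+1) = Φ(0,m)`. [cite: Merel1995Homologie, §1.2] -/
theorem jordan_generic (m : ℕ) (x y : ℕ → ℤ) (hx0 : x 0 = 1) (hy0 : y 0 = 0) (hypos : ∀ j, 1 ≤ j → j ≤ m → 0 < y j)
    (hdet : ∀ j, j < m → x j * y (j + 1) - x (j + 1) * y j = 1) (a c : ℤ) (s t : ℕ → ℤ)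
    (hs : ∀ j, s j = x j * c - y j * a) (Φ : ℕ → ℕ → ℤ)
    (hΦ : ∀ i k, Φ i k = if (0 < (-(s k)) * s i ∨ ((-(s k)) * s i = 0 ∧ (0 < (-(s k) + 2 * -(t k)) * (s i + 2 * t i) ∨
        ((-(s k) + 2 * -(t k)) * (s i + 2 * t i) = 0 ∧ 0 < (-(s k)) * t i + (-(t k)) * s i)))) then (1 : ℤ) else 0)
    (hne : ∀ j, j ≤ m → s j ≠ 0) :
    (∑ j ∈ Finset.range m, Φ j (j + 1)) = Φ 0 m := by
  have key : ∀ i k, s i ≠ 0 → s k ≠ 0 → Φ i k = if s i * s k < 0 then 1 else 0 := by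
    intro i k hi hk
    rw [hΦ]
    have hne0 : (-(s k)) * s i ≠ 0 := mul_ne_zero (neg_ne_zero.mpr hk) hi
    by_cases h : s i * s k < 0
    · rw [if_pos h, if_pos (Or.inl (by nlinarith))]
    · rw [if_neg h, if_neg]
      rintro (h1 | ⟨h1, -⟩)
      · exact h (by nlinarith)
      · exact hne0 h1
  have h1 : ∀ j ∈ Finset.range m, Φ j (j + 1) = if (x j * c - y j * a) * (x (j + 1) * c - y (j + 1) * a) < 0 then 1 else 0 := by
    intro j hj
    rw [Finset.mem_range] at hj
    rw [key j (j + 1) (hne j hj.le) (hne (j + 1) hj), hs, hs]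
  rw [Finset.sum_congr rfl h1, key 0 m (hne 0 (Nat.zero_le _)) (hne m le_rfl), hs, hs]
  clear h1 key
  exact jordan_generic_count m x y hx0 hy0 hypos hdet a c (fun j hj ↦ by rw [← hs]; exact hne j hj)

/-- **Vertex shape.** If `s_i = 0` (`i ≤ m`) then the flag sits at the vertex `P_i`: `(a, c) = ε P_i` with `ε = ±1` and `t_i = ε`
(primitivity of `P_i` via its Farey neighbour, and `ae − bc = 1`). [folklore] -/
theorem jordan_vertex_shape (m : ℕ) (x y : ℕ → ℤ) (hm : 1 ≤ m)
    (hdet : ∀ j, j < m → x j * y (j + 1) - x (j + 1) * y j = 1) (a b c e : ℤ) (hdet1 : a * e - b * c = 1) (s t : ℕ → ℤ)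
    (hs : ∀ j, s j = x j * c - y j * a) (ht : ∀ j, t j = x j * e - y j * b) (i : ℕ) (hi : i ≤ m) (hsi : s i = 0) :
    ∃ ε : ℤ, (ε = 1 ∨ ε = -1) ∧ a = ε * x i ∧ c = ε * y i ∧ t i = ε := by
  obtain ⟨α, β, hαβ⟩ : ∃ α β : ℤ, α * x i + β * y i = 1 := by
    rcases Nat.lt_or_ge i m with him | him
    · exact ⟨y (i + 1), -x (i + 1), by linear_combination hdet i him⟩
    · have : i = m := le_antisymm hi him
      subst this
      exact ⟨-y (i - 1), x (i - 1), by
        have h := hdet (i - 1) (by omega); rw [show i - 1 + 1 = i by omega] at h; linear_combination h⟩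
  rw [hs] at hsi
  set ε : ℤ := α * a + β * c with hε
  have ha : a = ε * x i := by rw [hε]; linear_combination (-a) * hαβ + (-β) * hsi
  have hc : c = ε * y i := by rw [hε]; linear_combination (-c) * hαβ + α * hsi
  have h1 : ε * t i = 1 := by rw [ht, ← hdet1, ha, hc]; ring
  rcases Int.eq_one_or_neg_one_of_mul_eq_one h1 with h | h
  · refine ⟨ε, Or.inl h, ha, hc, ?_⟩
    rw [h, one_mul] at h1; rw [h1, h]
  · refine ⟨ε, Or.inr h, ha, hc, ?_⟩
    rw [h] at h1; rw [h]; linarith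

end Phi

/-! ## §4. Evaluation of `Φ` at a vertex flag -/

section Vertex

/-- **Plücker identity**: `s_j t_k − s_k t_j = (x_j y_k − x_k y_j)(ae − bc)`. [folklore] -/
theorem jordan_pluecker (x y : ℕ → ℤ) (a b c e : ℤ) (s t : ℕ → ℤ)
    (hs : ∀ j, s j = x j * c - y j * a) (ht : ∀ j, t j = x j * e - y j * b) (j k : ℕ) :
    s j * t k - s k * t j = (x j * y k - x k * y j) * (a * e - b * c) := by
  rw [hs, hs, ht, ht]; ring

/-- At a vertex flag `(a,c) = ε P_i`: `s_j = ε·(x_j y_i − x_i y_j)`. [folklore] -/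
theorem jordan_vertex_s (x y : ℕ → ℤ) (a c : ℤ) (s : ℕ → ℤ) (hs : ∀ j, s j = x j * c - y j * a)
    (i : ℕ) (ε : ℤ) (ha : a = ε * x i) (hc : c = ε * y i) (j : ℕ) : s j = ε * (x j * y i - x i * y j) := by
  rw [hs, ha, hc]; ring

/-- **Non-incident edges contribute nothing**: at a vertex flag `(a,c) = εP_i`, for `j < m` with `j ≠ i`, `j + 1 ≠ i`:
`Φ(j, j+1) = 0` (the cusp `P_i` lies strictly on one side of the edge `[P_j | P_{j+1}]`: first key `−s_{j+1}s_j < 0` by convexity).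
[cite: Merel1995Homologie, §1.2] -/
theorem jordan_vertex_nonincident (m : ℕ) (x y : ℕ → ℤ) (hy0 : y 0 = 0) (hypos : ∀ j, 1 ≤ j → j ≤ m → 0 < y j)
    (hdet : ∀ j, j < m → x j * y (j + 1) - x (j + 1) * y j = 1) (a c : ℤ) (s t : ℕ → ℤ)
    (hs : ∀ j, s j = x j * c - y j * a) (Φ : ℕ → ℕ → ℤ)
    (hΦ : ∀ i k, Φ i k = if (0 < (-(s k)) * s i ∨ ((-(s k)) * s i = 0 ∧ (0 < (-(s k) + 2 * -(t k)) * (s i + 2 * t i) ∨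
        ((-(s k) + 2 * -(t k)) * (s i + 2 * t i) = 0 ∧ 0 < (-(s k)) * t i + (-(t k)) * s i)))) then (1 : ℤ) else 0)
    (i : ℕ) (hi : i ≤ m) (ε : ℤ) (hε : ε = 1 ∨ ε = -1) (ha : a = ε * x i) (hc : c = ε * y i)
    (j : ℕ) (hjm : j < m) (hji : j ≠ i) (hj1i : j + 1 ≠ i) : Φ j (j + 1) = 0 := by
  have hε2 : ε ^ 2 = 1 := by rcases hε with rfl | rfl <;> norm_num
  have hsj := jordan_vertex_s x y a c s hs i ε ha hc j
  have hsj1 := jordan_vertex_s x y a c s hs i ε ha hc (j + 1)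
  have hprod : 0 < (x j * y i - x i * y j) * (x (j + 1) * y i - x i * y (j + 1)) := by
    have hcross := negCF_cross_pos m x y hy0 hypos hdet
    rcases Nat.lt_or_ge (j + 1) i with hlt | hge
    · exact mul_pos (hcross j i (by omega) hi) (hcross (j + 1) i hlt hi)
    · have h1 : 0 < x i * y j - x j * y i := hcross i j (by omega) (by omega)
      have h2 : 0 < x i * y (j + 1) - x (j + 1) * y i := hcross i (j + 1) (by omega) (by omega)
      nlinarith
  have hkey : (-(s (j + 1))) * s j < 0 := by
    rw [hsj, hsj1]; nlinarith
  rw [hΦ, if_neg]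
  rintro (h | ⟨h, -⟩) <;> linarith

/-- **Incoming edge** `[P_{i−1} | P_i]` at the vertex flag (`1 ≤ i ≤ m`, `t_i = ε`): `Φ(i−1, i) = [ε·(s_{i−1} + 2t_{i−1}) < 0]`
(second key; `s_{i−1} = ε` so the bracket is odd, never zero). [cite: Merel1995Homologie, §1.2] -/
theorem jordan_vertex_in (m : ℕ) (x y : ℕ → ℤ)
    (hdet : ∀ j, j < m → x j * y (j + 1) - x (j + 1) * y j = 1) (a c : ℤ) (s t : ℕ → ℤ)
    (hs : ∀ j, s j = x j * c - y j * a) (Φ : ℕ → ℕ → ℤ)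
    (hΦ : ∀ i k, Φ i k = if (0 < (-(s k)) * s i ∨ ((-(s k)) * s i = 0 ∧ (0 < (-(s k) + 2 * -(t k)) * (s i + 2 * t i) ∨
        ((-(s k) + 2 * -(t k)) * (s i + 2 * t i) = 0 ∧ 0 < (-(s k)) * t i + (-(t k)) * s i)))) then (1 : ℤ) else 0)
    (i : ℕ) (hi1 : 1 ≤ i) (hi : i ≤ m) (ε : ℤ) (hε : ε = 1 ∨ ε = -1) (ha : a = ε * x i) (hc : c = ε * y i) (hti : t i = ε) :
    Φ (i - 1) i = if ε * (s (i - 1) + 2 * t (i - 1)) < 0 then 1 else 0 := by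
  have hε2 : ε * ε = 1 := by rcases hε with rfl | rfl <;> norm_num
  have hsi : s i = 0 := by rw [jordan_vertex_s x y a c s hs i ε ha hc i]; ring
  have hsim : s (i - 1) = ε := by
    rw [jordan_vertex_s x y a c s hs i ε ha hc (i - 1)]
    have h := hdet (i - 1) (by omega); rw [show i - 1 + 1 = i by omega] at h
    rw [h, mul_one]
  have hodd : ε * (s (i - 1) + 2 * t (i - 1)) ≠ 0 := by
    rw [hsim]; intro h
    have : (2 : ℤ) ∣ 1 := ⟨-(ε * t (i - 1)), by linear_combination h - hε2⟩
    omega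
  rw [hΦ, hsi, hti, neg_zero, zero_mul, zero_add]
  have e2 : (2 * -ε) * (s (i - 1) + 2 * t (i - 1)) = -2 * (ε * (s (i - 1) + 2 * t (i - 1))) := by ring
  rw [e2]
  by_cases h : ε * (s (i - 1) + 2 * t (i - 1)) < 0
  · rw [if_pos h, if_pos (Or.inr ⟨rfl, Or.inl (by linarith)⟩)]
  · rw [if_neg h, if_neg]
    rintro (h1 | ⟨-, h1 | ⟨h1, -⟩⟩)
    · exact lt_irrefl _ h1
    · exact h (by linarith)
    · exact hodd (by linarith)

/-- **Outgoing edge** `[P_i | P_{i+1}]` at the vertex flag (`i < m`, `t_i = ε`): `Φ(i, i+1) = [ε·(s_{i+1} + 2t_{i+1}) < 0]`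
(`s_{i+1} = −ε`, odd bracket). [cite: Merel1995Homologie, §1.2] -/
theorem jordan_vertex_out (m : ℕ) (x y : ℕ → ℤ)
    (hdet : ∀ j, j < m → x j * y (j + 1) - x (j + 1) * y j = 1) (a c : ℤ) (s t : ℕ → ℤ)
    (hs : ∀ j, s j = x j * c - y j * a) (Φ : ℕ → ℕ → ℤ)
    (hΦ : ∀ i k, Φ i k = if (0 < (-(s k)) * s i ∨ ((-(s k)) * s i = 0 ∧ (0 < (-(s k) + 2 * -(t k)) * (s i + 2 * t i) ∨
        ((-(s k) + 2 * -(t k)) * (s i + 2 * t i) = 0 ∧ 0 < (-(s k)) * t i + (-(t k)) * s i)))) then (1 : ℤ) else 0)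
    (i : ℕ) (hi : i < m) (ε : ℤ) (hε : ε = 1 ∨ ε = -1) (ha : a = ε * x i) (hc : c = ε * y i) (hti : t i = ε) :
    Φ i (i + 1) = if ε * (s (i + 1) + 2 * t (i + 1)) < 0 then 1 else 0 := by
  have hε2 : ε * ε = 1 := by rcases hε with rfl | rfl <;> norm_num
  have hsi : s i = 0 := by rw [jordan_vertex_s x y a c s hs i ε ha hc i]; ring
  have hsip : s (i + 1) = -ε := by
    rw [jordan_vertex_s x y a c s hs i ε ha hc (i + 1)]
    have h := hdet i hi
    linear_combination ε * (-h)
  have hodd : ε * (s (i + 1) + 2 * t (i + 1)) ≠ 0 := by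
    rw [hsip]; intro h
    have : (2 : ℤ) ∣ 1 := ⟨ε * t (i + 1), by linear_combination -h - hε2⟩
    omega
  rw [hΦ, hsi, hti, mul_zero]
  have e2 : (-(s (i + 1)) + 2 * -(t (i + 1))) * (0 + 2 * ε) = -2 * (ε * (s (i + 1) + 2 * t (i + 1))) := by ring
  rw [e2]
  by_cases h : ε * (s (i + 1) + 2 * t (i + 1)) < 0
  · rw [if_pos h, if_pos (Or.inr ⟨rfl, Or.inl (by linarith)⟩)]
  · rw [if_neg h, if_neg]
    rintro (h1 | ⟨-, h1 | ⟨h1, -⟩⟩)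
    · exact lt_irrefl _ h1
    · exact h (by linarith)
    · exact hodd (by linarith)

/-- **The long edge at an interior vertex** (`0 < i < m`): `Φ(0, m) = 1` (the cusp `P_i` lies strictly between `P₀ = ∞` and `P_m`
on the positive side). [cite: Merel1995Homologie, §1.2] -/
theorem jordan_vertex_long_mid (m : ℕ) (x y : ℕ → ℤ) (hy0 : y 0 = 0) (hypos : ∀ j, 1 ≤ j → j ≤ m → 0 < y j)
    (hdet : ∀ j, j < m → x j * y (j + 1) - x (j + 1) * y j = 1) (a c : ℤ) (s t : ℕ → ℤ)
    (hs : ∀ j, s j = x j * c - y j * a) (Φ : ℕ → ℕ → ℤ)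
    (hΦ : ∀ i k, Φ i k = if (0 < (-(s k)) * s i ∨ ((-(s k)) * s i = 0 ∧ (0 < (-(s k) + 2 * -(t k)) * (s i + 2 * t i) ∨
        ((-(s k) + 2 * -(t k)) * (s i + 2 * t i) = 0 ∧ 0 < (-(s k)) * t i + (-(t k)) * s i)))) then (1 : ℤ) else 0)
    (i : ℕ) (hi0 : 0 < i) (hi : i < m) (ε : ℤ) (hε : ε = 1 ∨ ε = -1) (ha : a = ε * x i) (hc : c = ε * y i) :
    Φ 0 m = 1 := by
  have hε2 : ε * ε = 1 := by rcases hε with rfl | rfl <;> norm_num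
  have hcross := negCF_cross_pos m x y hy0 hypos hdet
  have h0 : 0 < x 0 * y i - x i * y 0 := hcross 0 i hi0 hi.le
  have hm : 0 < x i * y m - x m * y i := hcross i m hi le_rfl
  have hkey : 0 < (-(s m)) * s 0 := by
    rw [jordan_vertex_s x y a c s hs i ε ha hc 0, jordan_vertex_s x y a c s hs i ε ha hc m]
    have e : -(ε * (x m * y i - x i * y m)) * (ε * (x 0 * y i - x i * y 0)) =
        (ε * ε) * ((x i * y m - x m * y i) * (x 0 * y i - x i * y 0)) := by ring
    rw [e, hε2, one_mul]
    exact mul_pos hm h0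
  rw [hΦ, if_pos (Or.inl hkey)]

/-- **The long edge at the initial vertex** `P₀ = ∞` (`i = 0 < m`, `t_0 = ε`): `Φ(0, m) = [ε·(s_m + 2t_m) ≤ 0]` (tie `= 0` broken by the
third key `y_m > 0`). [cite: Merel1995Homologie, §1.2] -/
theorem jordan_vertex_long_zero (m : ℕ) (x y : ℕ → ℤ) (hx0 : x 0 = 1) (hy0 : y 0 = 0) (hm : 1 ≤ m)
    (hypos : ∀ j, 1 ≤ j → j ≤ m → 0 < y j) (a c : ℤ) (s t : ℕ → ℤ)
    (hs : ∀ j, s j = x j * c - y j * a) (Φ : ℕ → ℕ → ℤ)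
    (hΦ : ∀ i k, Φ i k = if (0 < (-(s k)) * s i ∨ ((-(s k)) * s i = 0 ∧ (0 < (-(s k) + 2 * -(t k)) * (s i + 2 * t i) ∨
        ((-(s k) + 2 * -(t k)) * (s i + 2 * t i) = 0 ∧ 0 < (-(s k)) * t i + (-(t k)) * s i)))) then (1 : ℤ) else 0)
    (ε : ℤ) (hε : ε = 1 ∨ ε = -1) (ha : a = ε * x 0) (hc : c = ε * y 0) (ht0 : t 0 = ε) :
    Φ 0 m = if ε * (s m + 2 * t m) ≤ 0 then 1 else 0 := by
  have hε2 : ε * ε = 1 := by rcases hε with rfl | rfl <;> norm_num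
  have hs0 : s 0 = 0 := by rw [jordan_vertex_s x y a c s hs 0 ε ha hc 0]; ring
  have hsm : s m = -(ε * y m) := by rw [jordan_vertex_s x y a c s hs 0 ε ha hc m, hx0, hy0]; ring
  have hym : 0 < y m := hypos m hm le_rfl
  rw [hΦ, hs0, ht0, mul_zero, zero_add, mul_zero, add_zero]
  have e2 : (-(s m) + 2 * -(t m)) * (2 * ε) = -2 * (ε * (s m + 2 * t m)) := by ring
  have e3 : -(s m) * ε = y m := by rw [hsm]; linear_combination y m * hε2
  rw [e2, e3]
  rcases lt_trichotomy (ε * (s m + 2 * t m)) 0 with h | h | h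
  · rw [if_pos h.le, if_pos (Or.inr ⟨rfl, Or.inl (by linarith)⟩)]
  · rw [if_pos h.le, if_pos (Or.inr ⟨rfl, Or.inr ⟨by rw [h]; ring, hym⟩⟩)]
  · rw [if_neg (not_le.mpr h), if_neg]
    rintro (h1 | ⟨-, h1 | ⟨h1, -⟩⟩)
    · exact lt_irrefl _ h1
    · linarith
    · have : ε * (s m + 2 * t m) = 0 := by linarith
      exact h.ne' this

/-- **The long edge at the terminal vertex** `P_m` (`i = m ≥ 1`, `t_m = ε`): `Φ(0, m) = [ε·(s_0 + 2t_0) < 0]` (tie broken by the third key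
`−y_m < 0`). [cite: Merel1995Homologie, §1.2] -/
theorem jordan_vertex_long_last (m : ℕ) (x y : ℕ → ℤ) (hx0 : x 0 = 1) (hy0 : y 0 = 0) (hm : 1 ≤ m)
    (hypos : ∀ j, 1 ≤ j → j ≤ m → 0 < y j) (a c : ℤ) (s t : ℕ → ℤ)
    (hs : ∀ j, s j = x j * c - y j * a) (Φ : ℕ → ℕ → ℤ)
    (hΦ : ∀ i k, Φ i k = if (0 < (-(s k)) * s i ∨ ((-(s k)) * s i = 0 ∧ (0 < (-(s k) + 2 * -(t k)) * (s i + 2 * t i) ∨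
        ((-(s k) + 2 * -(t k)) * (s i + 2 * t i) = 0 ∧ 0 < (-(s k)) * t i + (-(t k)) * s i)))) then (1 : ℤ) else 0)
    (ε : ℤ) (hε : ε = 1 ∨ ε = -1) (ha : a = ε * x m) (hc : c = ε * y m) (htm : t m = ε) :
    Φ 0 m = if ε * (s 0 + 2 * t 0) < 0 then 1 else 0 := by
  have hε2 : ε * ε = 1 := by rcases hε with rfl | rfl <;> norm_num
  have hsm : s m = 0 := by rw [jordan_vertex_s x y a c s hs m ε ha hc m]; ring
  have hs0 : s 0 = ε * y m := by rw [jordan_vertex_s x y a c s hs m ε ha hc 0, hx0, hy0]; ring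
  have hym : 0 < y m := hypos m hm le_rfl
  rw [hΦ, hsm, htm, neg_zero, zero_mul, zero_add, zero_mul, zero_add]
  have e2 : (2 * -ε) * (s 0 + 2 * t 0) = -2 * (ε * (s 0 + 2 * t 0)) := by ring
  have e3 : -ε * s 0 = -(y m) := by rw [hs0]; linear_combination (-(y m)) * hε2
  rw [e2, e3]
  by_cases h : ε * (s 0 + 2 * t 0) < 0
  · rw [if_pos h, if_pos (Or.inr ⟨rfl, Or.inl (by linarith)⟩)]
  · rw [if_neg h, if_neg]
    rintro (h1 | ⟨-, h1 | ⟨-, h1⟩⟩)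
    · exact lt_irrefl _ h1
    · exact h (by linarith)
    · linarith

end Vertex

end Summit.BirchSwinnertonDyer.BirchSwinnertonDyer.Theorems.ThetaLayerLambdaCongruenceAtTwo

end
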